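import Summits.Parity.GeneralizedHardyLittlewood.Theorems.PrimeLevelFamEdgeMomentsBeyondDiagonalDiagPrimeSum
import HarnessLib

/-!
# Route `PrimeLevelFamEdge`, crux K_A `MomentsBeyondDiagonal` (stmt-Parity-20007), line «petersson_layers» v4, stub `stub_diag`:
# **weighted Mertens moments with a prime-log power:
# `Σ_{p≤y, p∤n}(log p/(p−1))·log^j p·logᵃ(y/p) = (j!·a!/(a+j+1)!)·log^{a+j+1}y + O_j((1+κ(n))(1+log y)^{a+j})`**

The first brick of the `M₄`-engine asked for by rung 2 of `stub_diag` (`…DiagRungTwoOfM4`, `…DiagDecorOrderTwoTwoAssembly`,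
census note): the `P₄ = Σ_{p∣k}log⁴p`- and `P₂²`-decorated coprime Selberg sums are evaluated, as the `P₂`-decorated one was in
`…DiagDecorPrimeSqTerm/…DiagDecorPrimeSq`, by peeling the prime `p` (`…DiagDecorPrime.sum_copTauW_mul_mul_sum_primeFactors_eq`
with `g(p) = log⁴p`), evaluating the inner coprime sum at `y/p`, and summing over `p` against the weights
`v(p) = log p/(p−1)`: the main part is then the Mertens moment `Σ_{p∤n} v(p)·log^{j}p·log^{c−2}(y/p)` with `j = 3`
(`…DiagDecorPrimeSqTerm.abs_sum_primeWeight_log_mul_log_pow_sub_le` is the case `j = 1`). This file proves the moment for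
EVERY `j` (Beta integral `∫₀¹x^a(1−x)^j = a!j!/(a+j+1)!`, by induction on `j` through `log p = log y − log(y/p)`):

* `primeWeight_logPow_succ_mul` — the pointwise recursion `v(p)log^{j+1}p·uᵃ = log y·(v(p)log^jp·uᵃ) − v(p)log^jp·u^{a+1}`
  (`u = log(y/p)`);
* `beta_factorial_step` — the factorial identity behind the recursion of the main terms;
* `abs_sum_primeWeight_coprime_logPow_mul_log_pow_sub_le` — **the displayed moment, error `2^j(19+κ(n))(1+log y)^{a+j}`**
  (`j = 0`: `…DiagPrimeSum.abs_sum_primeWeight_coprime_mul_log_pow_sub_le`).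

Def-free; theorems only. Helper `--supports stmt-Parity-20007`; closes nothing; K_A, K_B and the Parity summit are NOT proved;
nothing about Landau–Siegel zeros.

## References
* T. M. Apostol, *Introduction to Analytic Number Theory*, Springer 1976, Thm 4.9 (Mertens' `Σ_{p≤x}log p/p = log x + O(1)`).
  [cite: Apostol1976, Thm 4.9 — derivation (weighted moments by partial summation / induction on the log power)]
* E. Kowalski, P. Michel, J. VanderKam, J. reine angew. Math. 526 (2000), Prop. 5.1 p. 18.
  [cite: KowalskiMichelVanderKam2000, Prop. 5.1 — derivation (prime sums of the Hecke coupling, coprime to `n`)]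
-/

noncomputable section

open scoped Real
open Finset ArithmeticFunction

namespace Summit.Parity.GeneralizedHardyLittlewood.Theorems.MomentsBeyondDiagonal.DiagKernel

open Literature.NumberTheory.LFunctions Literature.NumberTheory.LFunctions.KMV2000
open SelbergCoord (kappa)

/-- The pointwise recursion: for `1 ≤ k` and `0 < y`,
`w(k)·(log^{j+1}k·logᵃ(y/k)) = log y·(w(k)·(log^jk·logᵃ(y/k))) − w(k)·(log^jk·log^{a+1}(y/k))` for any weight `w(k)`,
since `log k = log y − log(y/k)`. [folklore] -/
theorem primeWeight_logPow_succ_mul {y : ℝ} (hy : 0 < y) {k : ℕ} (hk : k ≠ 0) (w : ℝ) (j a : ℕ) :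
    w * (Real.log k ^ (j + 1) * Real.log (y / k) ^ a) =
      Real.log y * (w * (Real.log k ^ j * Real.log (y / k) ^ a)) - w * (Real.log k ^ j * Real.log (y / k) ^ (a + 1)) := by
  have hk' : (k : ℝ) ≠ 0 := by exact_mod_cast hk
  rw [Real.log_div hy.ne' hk']
  ring

/-- The factorial identity behind the recursion of the main terms:
`L·(j!a!/(a+j+1)!)·L^{a+j+1} − (j!(a+1)!/(a+j+2)!)·L^{a+j+2} = ((j+1)!a!/(a+j+2)!)·L^{a+j+2}`. [folklore] -/
theorem beta_factorial_step (L : ℝ) (j a : ℕ) :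
    L * ((j.factorial : ℝ) * a.factorial / (a + j + 1).factorial * L ^ (a + j + 1)) -
        (j.factorial : ℝ) * (a + 1).factorial / (a + 1 + j + 1).factorial * L ^ (a + 1 + j + 1) =
      ((j + 1).factorial : ℝ) * a.factorial / (a + (j + 1) + 1).factorial * L ^ (a + (j + 1) + 1) := by
  have e1 : a + 1 + j + 1 = a + j + 1 + 1 := by ring
  have e2 : a + (j + 1) + 1 = a + j + 1 + 1 := by ring
  rw [e1, e2, Nat.factorial_succ (a + j + 1), Nat.factorial_succ a, Nat.factorial_succ j]
  have hF : ((a + j + 1).factorial : ℝ) ≠ 0 := by exact_mod_cast Nat.factorial_ne_zero _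
  have hS : ((a + j + 1 + 1 : ℕ) : ℝ) ≠ 0 := Nat.cast_ne_zero.2 (by omega)
  push_cast
  field_simp
  ring

/-- **Weighted Mertens moments with a prime-log power** (`n ≥ 1`, `y ≥ 1`, all `j, a`):
`|Σ_{p≤y, p∤n}(log p/(p−1))·log^jp·logᵃ(y/p) − (j!a!/(a+j+1)!)·log^{a+j+1}y| ≤ 2^j·(19+κ(n))·(1+log y)^{a+j}`.
[cite: Apostol1976, Thm 4.9 — derivation (induction on `j` over the coprime Mertens moments)] -/
theorem abs_sum_primeWeight_coprime_logPow_mul_log_pow_sub_le {n : ℕ} (hn : n ≠ 0) {y : ℝ} (hy : 1 ≤ y) (j a : ℕ) :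
    |∑ k ∈ Icc 1 ⌊y⌋₊, (if k.Prime ∧ ¬ k ∣ n then Real.log k / ((k : ℝ) - 1) else 0) *
          (Real.log k ^ j * Real.log (y / k) ^ a) -
        (j.factorial : ℝ) * a.factorial / (a + j + 1).factorial * Real.log y ^ (a + j + 1)| ≤
      2 ^ j * (19 + kappa n) * (1 + Real.log y) ^ (a + j) := by
  have hy0 : 0 < y := by linarith
  have hly : 0 ≤ Real.log y := Real.log_nonneg hy
  have hκ : 0 ≤ kappa n := by
    unfold kappa
    exact Finset.sum_nonneg fun p hp ↦ by
      have hp2 : (2 : ℝ) ≤ p := by exact_mod_cast (Nat.prime_of_mem_primeFactors hp).two_le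
      exact div_nonneg (Real.log_nonneg (by linarith)) (by linarith)
  induction j generalizing a with
  | zero =>
    have h0 := abs_sum_primeWeight_coprime_mul_log_pow_sub_le hn hy a
    have hmain : ((Nat.factorial 0 : ℕ) : ℝ) * a.factorial / (a + 0 + 1).factorial * Real.log y ^ (a + 0 + 1) =
        Real.log y ^ (a + 1) / ((a : ℝ) + 1) := by
      rw [Nat.add_zero, Nat.factorial_succ a, Nat.factorial_zero]
      have ha : (a.factorial : ℝ) ≠ 0 := by exact_mod_cast Nat.factorial_ne_zero _
      have ha1 : ((a + 1 : ℕ) : ℝ) ≠ 0 := Nat.cast_ne_zero.2 (by omega)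
      push_cast
      field_simp
    have hsum : ∑ k ∈ Icc 1 ⌊y⌋₊, (if k.Prime ∧ ¬ k ∣ n then Real.log k / ((k : ℝ) - 1) else 0) *
          (Real.log k ^ 0 * Real.log (y / k) ^ a) =
        ∑ k ∈ Icc 1 ⌊y⌋₊, (if k.Prime ∧ ¬ k ∣ n then Real.log k / ((k : ℝ) - 1) else 0) * Real.log (y / k) ^ a :=
      Finset.sum_congr rfl fun k _ ↦ by rw [pow_zero, one_mul]
    rw [hsum, hmain, pow_zero, one_mul, Nat.add_zero]
    exact h0
  | succ j ih =>
    -- the recursion `S_{j+1,a} = log y · S_{j,a} − S_{j,a+1}`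
    have hrec : ∑ k ∈ Icc 1 ⌊y⌋₊, (if k.Prime ∧ ¬ k ∣ n then Real.log k / ((k : ℝ) - 1) else 0) *
          (Real.log k ^ (j + 1) * Real.log (y / k) ^ a) =
        Real.log y * ∑ k ∈ Icc 1 ⌊y⌋₊, (if k.Prime ∧ ¬ k ∣ n then Real.log k / ((k : ℝ) - 1) else 0) *
            (Real.log k ^ j * Real.log (y / k) ^ a) -
          ∑ k ∈ Icc 1 ⌊y⌋₊, (if k.Prime ∧ ¬ k ∣ n then Real.log k / ((k : ℝ) - 1) else 0) *
            (Real.log k ^ j * Real.log (y / k) ^ (a + 1)) := by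
      rw [Finset.mul_sum, ← Finset.sum_sub_distrib]
      refine Finset.sum_congr rfl fun k hk ↦ ?_
      have hk0 : k ≠ 0 := by have := (Finset.mem_Icc.1 hk).1; omega
      exact primeWeight_logPow_succ_mul hy0 hk0 _ j a
    have h1 := ih a
    have h2 := ih (a + 1)
    rw [hrec, ← beta_factorial_step (Real.log y) j a]
    -- |L·S − T − (L·m − m')| ≤ L·|S − m| + |T − m'|
    have key : ∀ {L S T m m' : ℝ}, L * S - T - (L * m - m') = L * (S - m) - (T - m') := fun {L S T m m'} ↦ by ring
    rw [key]
    refine (abs_sub _ _).trans ?_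
    rw [abs_mul, abs_of_nonneg hly]
    have hL1 : Real.log y ≤ 1 + Real.log y := by linarith
    have hX : 0 ≤ 2 ^ j * (19 + kappa n) * (1 + Real.log y) ^ (a + j) := by positivity
    calc Real.log y * |∑ k ∈ Icc 1 ⌊y⌋₊, (if k.Prime ∧ ¬ k ∣ n then Real.log k / ((k : ℝ) - 1) else 0) *
              (Real.log k ^ j * Real.log (y / k) ^ a) -
            (j.factorial : ℝ) * a.factorial / (a + j + 1).factorial * Real.log y ^ (a + j + 1)| +
          |∑ k ∈ Icc 1 ⌊y⌋₊, (if k.Prime ∧ ¬ k ∣ n then Real.log k / ((k : ℝ) - 1) else 0) *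
              (Real.log k ^ j * Real.log (y / k) ^ (a + 1)) -
            (j.factorial : ℝ) * (a + 1).factorial / (a + 1 + j + 1).factorial * Real.log y ^ (a + 1 + j + 1)|
        ≤ Real.log y * (2 ^ j * (19 + kappa n) * (1 + Real.log y) ^ (a + j)) +
            2 ^ j * (19 + kappa n) * (1 + Real.log y) ^ (a + 1 + j) :=
          add_le_add (mul_le_mul_of_nonneg_left h1 hly) h2
      _ ≤ (1 + Real.log y) * (2 ^ j * (19 + kappa n) * (1 + Real.log y) ^ (a + j)) +
            2 ^ j * (19 + kappa n) * (1 + Real.log y) ^ (a + 1 + j) :=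
          add_le_add (mul_le_mul_of_nonneg_right hL1 hX) le_rfl
      _ = 2 ^ (j + 1) * (19 + kappa n) * (1 + Real.log y) ^ (a + (j + 1)) := by
          ring

end Summit.Parity.GeneralizedHardyLittlewood.Theorems.MomentsBeyondDiagonal.DiagKernel

end
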